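import Literature.Computability.AlgebraicComplexity.AlmanLi2026ThreeByThree
import Literature.Computability.AlgebraicComplexity.PencilBorderRankThree
import Literature.Computability.AlgebraicComplexity.OneSliceSpeedup
import HarnessLib

/-!
# Proof of Alman–Li 2026, Prop. 4.3: every `3 × 3 × 3` tensor is a degeneration of `⟨3⟩ ⊕ ⟨1,2,1⟩`

Topic `Literature/Computability/AlgebraicComplexity`. Discharges the named fact
`AlmanLi2026_prop43` of `AlmanLi2026ThreeByThree.lean`:
over an algebraically closed field `F`, every `T : Fin 3 → Fin 3 → Fin 3 → F` satisfies
`AlgDegeneratesTo (⟨3⟩ ⊕ matMulTensor F 2 1 1) T` (J. Alman, B. Li, arXiv:2605.21738, Prop. 4.3,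
pp. 9–10 of the held text).

## The printed proof and this one

The paper (p. 9): "degeneration can be characterized topologically … `T ⊴ ⟨3⟩ ⊕ ⟨1,2,1⟩` iff `T` lies
in the Zariski closure of the set of restrictions; thus it suffices to restrict a GENERIC `T`": with a
nonsingular `z₁`-slice normalised to `∑ xᵢyᵢ` and a diagonalised `z₂`-slice,
`T = ∑ᵢ xᵢyᵢ(z₁ + αᵢz₂ + λz₃) + x(M - λI)y z₃` (`λ` an eigenvalue of `M`), the first sum a restriction
of `⟨3⟩`, the second (a matrix of rank `≤ 2` times `z₃`) of `⟨1,2,1⟩`. The closure theorem invoked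
(orbit closure = algebraic degenerations, BCS Thm. 20.24 / Strassen 1987) is not in the tree, so the
genericity step is replaced here by an EXPLICIT degeneration valid for every `T`, keeping the paper's
two ingredients:

* **a singular slice is split off** (`exists_singular_direction`, `exists_eq_sum_two_of_det_eq_zero`):
  `det (∑ₗ gₗ T(·,·,l))` is a cubic form in `g`, so some `g ≠ 0` gives a SINGULAR slice `N` (this is the
  paper's "`M - λI`"); after a change of basis `Z` of the third leg with `Z e₀ = g`
  (`T ≤ T'`, `tensorRestrictsTo_of_baseChange₃`) the slice `T'(·,·,0) = N = a₀b₀ᵀ + a₁b₁ᵀ` is a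
  restriction of `⟨1,2,1⟩ = matMulTensor F 2 1 1`;
* **the remaining two slices are a degeneration of `⟨3⟩`**: this is
  `MatrixPencil.algDegeneratesTo_unitTensor_pencil` (`PencilBorderRankThree.lean`: every `3 × 3 × 2`
  tensor has border rank `≤ 3`, BCS Example (20.5)(2), proved there explicitly) — for the paper's
  generic `T` this is its rank-`3` part `∑ᵢ xᵢyᵢ(z₁ + αᵢz₂ + λz₃)`;
* **assembly** (`isApproxRestriction_assembly`): block matrices realise
  `pad(P) + N ⊗ e₀ ⊴_h ⟨3⟩ ⊕ ⟨1,2,1⟩` from `P ⊴_h ⟨3⟩` and `N = ∑_{k<2} aₖ ⊗ bₖ` (the `⟨1,2,1⟩`-block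
  of the third-leg matrix carries `ε^h`), and `T ≤ T' ⊴ S` gives `T ⊴ S`
  (`AlgDegeneratesTo.trans_restrictsTo`).

## References

* J. Alman, B. Li, *Asymptotic Rank Speedup Theorems, Revisited*, arXiv:2605.21738 (2026), Prop. 4.3.
  [AlmanLi2026]
* P. Bürgisser, M. Clausen, M. A. Shokrollahi, *Algebraic Complexity Theory*, Springer 1997, (15.19),
  (15.25), Example (20.5)(2). [BurgisserClausenShokrollahi1997]
-/

noncomputable section

open scoped BigOperators Polynomial
open Matrix Polynomial

namespace Literature.Computability.AlgebraicComplexity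

namespace AlmanLi2026Prop43

variable {F : Type*} [Field F]

/-- A singular `3 × 3` matrix is a sum of two rank-one matrices: if `N v = 0` with `vᵢ ≠ 0`, the
`i`-th column is a combination of the other two (the paper's "`x(M - λI)y` is a restriction of
`⟨1,2,1⟩`"). [folklore] -/
theorem exists_eq_sum_two_of_det_eq_zero {N : Matrix (Fin 3) (Fin 3) F} (hN : N.det = 0) :
    ∃ p q : Fin 2 → Fin 3 → F, ∀ a b, N a b = ∑ k, p k a * q k b := by
  classical
  obtain ⟨v, hv0, hv⟩ := Matrix.exists_mulVec_eq_zero_iff.2 hN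
  obtain ⟨i, hi⟩ : ∃ i, v i ≠ 0 := by
    by_contra! h
    exact hv0 (funext h)
  refine ⟨fun k a => N a (i.succAbove k),
    fun k b => if b = i then -(v (i.succAbove k) / v i) else if b = i.succAbove k then 1 else 0,
    fun a b => ?_⟩
  by_cases hb : b = i
  · rw [hb]
    simp only [if_true]
    have hrow : N a i * v i + ∑ k, N a (i.succAbove k) * v (i.succAbove k) = 0 := by
      have := congrFun hv a
      simp only [Matrix.mulVec, dotProduct, Pi.zero_apply] at this
      rwa [Fin.sum_univ_succAbove _ i] at this
    calc N a i = (N a i * v i) / v i := by rw [mul_div_assoc, div_self hi, mul_one]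
      _ = -(∑ k, N a (i.succAbove k) * v (i.succAbove k)) / v i := by
          rw [eq_neg_of_add_eq_zero_left hrow]
      _ = ∑ k, N a (i.succAbove k) * -(v (i.succAbove k) / v i) := by
          rw [neg_div, Finset.sum_div, ← Finset.sum_neg_distrib]
          exact Finset.sum_congr rfl fun k _ => by ring
  · obtain ⟨k₀, hk₀⟩ := Fin.exists_succAbove_eq hb
    simp only [hb, if_false]
    rw [Finset.sum_eq_single k₀]
    · rw [if_pos hk₀.symm, mul_one, hk₀]
    · intro k _ hk
      rw [if_neg, mul_zero]
      intro hbk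
      apply hk
      have : i.succAbove k = i.succAbove k₀ := by rw [hk₀, hbk]
      exact Fin.succAbove_right_injective this
    · simp

/-- Every `3 × 3 × 3` tensor over an algebraically closed field has a nonzero SINGULAR
`z`-direction `g`: `det (∑ₗ gₗ T(·,·,l)) = 0` (a singular member of the pencil of the slices `0`
and `2`; the paper's choice of an eigenvalue `λ`). [cite: AlmanLi2026, Proposition 4.3] -/
theorem exists_singular_direction [IsAlgClosed F] (T : Fin 3 → Fin 3 → Fin 3 → F) :
    ∃ g : Fin 3 → F, g ≠ 0 ∧ (Matrix.of fun a b => ∑ l, g l * T a b l).det = 0 := by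
  obtain ⟨s, t, hst, hdet⟩ := MatrixPencil.exists_det_smul_add_smul_eq_zero
    (Matrix.of fun a b => T a b 0) (Matrix.of fun a b => T a b 2)
  refine ⟨![s, 0, t], ?_, ?_⟩
  · intro h
    rcases hst with hs | ht
    · exact hs (by simpa using congrFun h 0)
    · exact ht (by simpa using congrFun h 2)
  · convert hdet using 2
    ext a b
    simp [Fin.sum_univ_three]

/-- Change of basis in the third leg: `T` is a restriction of `T'(x, y, e_l) = T(x, y, Z e_l)` when
`Z` is invertible (matrices `1, 1, Z⁻ᵀ`; BCS (15.20)). [folklore] -/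
theorem tensorRestrictsTo_of_baseChange₃ {Z : Matrix (Fin 3) (Fin 3) F} (hZ : IsUnit Z.det)
    (T : Fin 3 → Fin 3 → Fin 3 → F) :
    TensorRestrictsTo (fun a b l => ∑ m, Z m l * T a b m) T := by
  classical
  refine ⟨fun a a' => if a' = a then 1 else 0, fun b b' => if b' = b then 1 else 0,
    fun m l => Z⁻¹ l m, fun a b m => ?_⟩
  rw [Finset.sum_eq_single_of_mem a (Finset.mem_univ a) (fun x _ hx => by simp [hx]),
    Finset.sum_eq_single_of_mem b (Finset.mem_univ b) (fun y _ hy => by simp [hy])]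
  simp only [if_true, one_mul]
  have key : ∀ m', (∑ l, Z⁻¹ l m * Z m' l) = if m' = m then 1 else 0 := by
    intro m'
    have := congrFun (congrFun (Matrix.mul_nonsing_inv Z hZ) m') m
    rw [Matrix.mul_apply, Matrix.one_apply] at this
    rw [← this]
    exact Finset.sum_congr rfl fun l _ => mul_comm _ _
  calc T a b m = ∑ m', (if m' = m then 1 else 0) * T a b m' := by
        simp only [ite_mul, one_mul, zero_mul, Finset.sum_ite_eq', Finset.mem_univ, if_true]
    _ = ∑ m', (∑ l, Z⁻¹ l m * Z m' l) * T a b m' := by simp_rw [key]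
    _ = ∑ l, Z⁻¹ l m * ∑ m', Z m' l * T a b m' := by
        simp only [Finset.sum_mul, Finset.mul_sum]
        rw [Finset.sum_comm]
        exact Finset.sum_congr rfl fun l _ => Finset.sum_congr rfl fun m' _ => by ring

/-- Sums against the source `⟨3⟩ ⊕ ⟨1,2,1⟩` (`⟨1,2,1⟩ = matMulTensor F 2 1 1`, an identity `2 × 2`
matrix with a trivial third factor) split into the two diagonal blocks. [folklore] -/
theorem sum_directSum_unitTensor_matMulTensor (f g : Fin 3 ⊕ (Fin 2 × Fin 1) → F[X])
    (k : Fin 3 ⊕ (Fin 1 × Fin 1) → F[X]) :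
    (∑ α, ∑ β, ∑ γ, f α * g β * k γ *
      C (directSumTensor (unitTensor F 3) (matMulTensor F 2 1 1) α β γ)) =
      (∑ a : Fin 3, ∑ b : Fin 3, ∑ c : Fin 3, f (Sum.inl a) * g (Sum.inl b) * k (Sum.inl c) *
          C (unitTensor F 3 a b c)) +
        ∑ κ : Fin 2, f (Sum.inr (κ, 0)) * g (Sum.inr (κ, 0)) * k (Sum.inr (0, 0)) := by
  simp only [Fintype.sum_sum_type, directSumTensor_inl, directSumTensor_inr,
    directSumTensor_inl_inr, directSumTensor_inr_inl, directSumTensor_mixed₃_inr,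
    directSumTensor_mixed₃_inl, map_zero, mul_zero, Finset.sum_const_zero, add_zero, zero_add,
    Fintype.sum_prod_type, Fintype.sum_unique, matMulTensor]
  congr 1
  refine Finset.sum_congr rfl fun κ _ => ?_
  rw [Finset.sum_eq_single κ (fun κ' _ h => by simp [Ne.symm h]) (by simp)]
  simp

/-- **Assembly.** If the slices `1, 2` of `T'` form a degeneration of order `h` of `⟨3⟩` (matrices
`A, B, Cm` over `F[ε]`) and the slice `0` is `∑_{k<2} pₖ ⊗ qₖ`, then the block matrices
`x ↦ (A x ·, pₖ(x))`, `y ↦ (B y ·, qₖ(y))`, `z ↦ (Cm · padded by 0 at z = 0, ε^h [z = 0])` realise a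
degeneration of order `h` of `T'` from `⟨3⟩ ⊕ ⟨1,2,1⟩` (BCS (15.19); the paper's
"first summation ≤ ⟨3⟩, second term ≤ ⟨1,2,1⟩", with the order of the two blocks aligned by `ε^h`).
[cite: AlmanLi2026, Proposition 4.3] -/
theorem isApproxRestriction_assembly {h : ℕ} {T' : Fin 3 → Fin 3 → Fin 3 → F}
    {A B : Fin 3 → Fin 3 → F[X]} {Cm : Fin 2 → Fin 3 → F[X]}
    (hP : IsApproxRestriction h (unitTensor F 3) (fun a b k => T' a b (Fin.succ k)) A B Cm)
    {p q : Fin 2 → Fin 3 → F} (hN : ∀ a b, T' a b 0 = ∑ k, p k a * q k b) :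
    IsApproxRestriction h (directSumTensor (unitTensor F 3) (matMulTensor F 2 1 1)) T'
      (fun x => Sum.elim (fun i => A x i) fun κ => C (p κ.1 x))
      (fun y => Sum.elim (fun i => B y i) fun κ => C (q κ.1 y))
      (fun z => Sum.elim (fun i => Fin.cases (motive := fun _ => F[X]) 0 (fun k => Cm k i) z)
        fun _ => X ^ h * C (if z = 0 then 1 else 0)) := by
  intro x y z j hj
  rw [sum_directSum_unitTensor_matMulTensor]
  simp only [Sum.elim_inl, Sum.elim_inr]
  have e2 : ∑ κ : Fin 2, C (p κ x) * C (q κ y) * (X ^ h * C (if z = 0 then (1 : F) else 0)) =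
      X ^ h * C ((∑ κ, p κ x * q κ y) * if z = 0 then 1 else 0) := by
    simp only [map_mul, map_sum, Finset.sum_mul, Finset.mul_sum]
    exact Finset.sum_congr rfl fun κ _ => by ring
  rw [e2]
  cases z using Fin.cases with
  | zero =>
    have e1 : ∑ a : Fin 3, ∑ b : Fin 3, ∑ c : Fin 3, A x a * B y b *
        (Fin.cases (motive := fun _ => F[X]) 0 (fun k => Cm k c) 0) * C (unitTensor F 3 a b c) = 0 := by
      simp
    rw [e1, zero_add, Polynomial.coeff_X_pow_mul', if_pos rfl, mul_one]
    by_cases hjh : j = h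
    · subst hjh
      simp [hN]
    · have : ¬h ≤ j := by omega
      simp [this, hjh]
  | succ k =>
    simp only [Fin.cases_succ, Fin.succ_ne_zero, if_false, mul_zero, map_zero, add_zero]
    exact hP x y k j hj

end AlmanLi2026Prop43

open AlmanLi2026Prop43 in
/-- **Alman–Li 2026, Proposition 4.3** (proved): over an algebraically closed field `F`, every
tensor `T ∈ F³ ⊗ F³ ⊗ F³` is a degeneration of `⟨3⟩ ⊕ ⟨1,2,1⟩`,
`AlgDegeneratesTo (directSumTensor (unitTensor F 3) (matMulTensor F 2 1 1)) T`. Proof: choose a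
singular `z`-direction `g` and an invertible `Z` with `Z e₀ = g`; the base-changed `T'` has a singular
slice `T'(·,·,0) = ∑_{k<2} pₖ ⊗ qₖ` and its slices `1, 2` are a degeneration of `⟨3⟩`
(`MatrixPencil.algDegeneratesTo_unitTensor_pencil`); assemble and pull back along `T ≤ T'`
(module docstring for the comparison with the printed generic-`T` argument).
[cite: AlmanLi2026, Proposition 4.3] -/
theorem AlmanLi2026_prop43_holds : AlmanLi2026_prop43 := by
  intro F _ _ T
  classical
  obtain ⟨g, hg0, hdet⟩ := exists_singular_direction T
  obtain ⟨Z, hZ, hZc⟩ := MatrixPencil.exists_isUnit_det_col_zero₃ hg0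
  obtain ⟨T', hT'⟩ : ∃ T' : Fin 3 → Fin 3 → Fin 3 → F, T' = fun a b l => ∑ m, Z m l * T a b m :=
    ⟨_, rfl⟩
  have hres : TensorRestrictsTo T' T := hT' ▸ tensorRestrictsTo_of_baseChange₃ hZ T
  have hN : (Matrix.of fun a b => T' a b 0).det = 0 := by
    have : (Matrix.of fun a b => T' a b 0) = Matrix.of fun a b => ∑ l, g l * T a b l := by
      ext a b; simp [hT', hZc]
    rw [this]; exact hdet
  obtain ⟨p, q, hpq⟩ := exists_eq_sum_two_of_det_eq_zero hN
  obtain ⟨h, A, B, Cm, hP⟩ := MatrixPencil.algDegeneratesTo_unitTensor_pencil (F := F)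
    (Matrix.of fun a b => T' a b 1) (Matrix.of fun a b => T' a b 2)
  have hP' : IsApproxRestriction h (unitTensor F 3) (fun a b k => T' a b k.succ) A B Cm := by
    have e : (fun a b (k : Fin 2) => T' a b k.succ) =
        fun a b k => ![(Matrix.of fun a b => T' a b 1) a b, (Matrix.of fun a b => T' a b 2) a b] k := by
      funext a b k; fin_cases k <;> rfl
    rw [e]; exact hP
  have hpq' : ∀ a b, T' a b 0 = ∑ k, p k a * q k b := fun a b => hpq a b
  exact AlgDegeneratesTo.trans_restrictsTo ⟨h, _, _, _, isApproxRestriction_assembly hP' hpq'⟩ hres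

end Literature.Computability.AlgebraicComplexity

end
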